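import Summits.SmoothPoincare4.SmoothPoincare4.Theses.VerlindeRLinks
import Literature.Topology.FourManifolds.AttachmentBoundarySurgeryLink

/-!
# Line `kirby-lemma21`, Stub 2 (`stub_isSurgery_boundary_of_isMultiAttachment`): Kirby's Lemma 2.1
# for links — the boundary of `D⁴ ∪_L (2-handles)` is the surgery on `L`
(crux `VerlindeRLinks.VrlComponentsHBallSlice`, item stmt-SmoothPoincare4-15874)

This file states and proves the registered stub `stub_isSurgery_boundary_of_isMultiAttachment`
(signature verbatim from the skeleton `Cruxes/VrlComponentsHBallSlice/Lines/kirby_lemma21.lean`): if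
`P` is `D⁴` with `2`-handles attached simultaneously (Kosinski, `HandleAttachingMap.IsMultiAttachment`)
along attaching maps `gᵢ : T → D⁴` whose values on the unit disc bundle of `T ∩ ∂D⁴` are pairwise
disjoint oriented tubular neighbourhoods `νᵢ` of the components of a framed link `L ⊂ S³ = ∂D⁴`
realising the framings `L.framing i`, then for EVERY boundary datum `bP` of `P` the boundary
`3`-manifold `bP.carrier` is the integral surgery on `L` (`L.IsSurgery (𝓡 3) bP.carrier`).  The
mathematics is the Literature theorem `FramedLink.isSurgery_boundary_of_isMultiAttachment`
(`AttachmentBoundarySurgeryLink.lean`, Kirby 1989 Ch. I Lemma 2.1 for links, landed with this stub);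
here only the instantiation at `ι = Fin n`, `P : Type`.

References: R. C. Kirby, *The Topology of 4-Manifolds*, LNM 1374 (1989), Ch. I §2 Lemma 2.1, §5;
R. E. Gompf, A. I. Stipsicz, *4-Manifolds and Kirby Calculus* (1999), §5.3; A. A. Kosinski,
*Differential Manifolds* (1993), VI §6.
-/

noncomputable section

-- the prescribed namespace `Summit.<P>.<Sub>.…` duplicates `SmoothPoincare4` (P = Sub)
set_option linter.dupNamespace false

open scoped Manifold ContDiff Topology
open Set Function Literature.Topology.FourManifolds

namespace Summit.SmoothPoincare4.SmoothPoincare4.Theorems.VrlComponentsHBallSlice.KirbyLemma21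

/-- **Stub 2 of line `kirby-lemma21` — Kirby's Lemma 2.1 for links**
(`stub_isSurgery_boundary_of_isMultiAttachment`, registered signature verbatim): the boundary of
`D⁴` with `2`-handles attached along attaching maps whose boundary values are pairwise disjoint
framed tubes of the components of `L` is, for every boundary datum, the integral surgery on `L`
(`FramedLink.isSurgery_boundary_of_isMultiAttachment` at `ι = Fin n`, `P : Type`).
[cite: Kirby1989, Ch. I §2 Lemma 2.1] [cite: GompfStipsicz1999, §5.3] -/
theorem stub_isSurgery_boundary_of_isMultiAttachment :
    ∀ (n : ℕ) (L : FramedLink (Fin n))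
      (g : Fin n → HandleAttachingMap 3 2 (Metric.closedBall (0 : EuclideanSpace ℝ (Fin 4)) 1))
      (ν : ∀ i, Knot.TubularNbhd ⇑(L.component i)),
      (∀ i, (ν i).HasFraming (L.framing i)) →
      (Pairwise fun i j => Disjoint (range ⇑(ν i)) (range ⇑(ν j))) →
      (∀ (i : Fin n) (y : ↥(handleTube 3 2)), tubeDepth y = 0 →
        (g i).toFun y = (closedBallBoundaryData 3).incl (ν i (tubeAngle y, tubeFibre y))) →
      ∀ (P : Type) [TopologicalSpace P] [ChartedSpace (EuclideanHalfSpace 4) P]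
        [IsManifold (𝓡∂ 4) ((⊤ : ℕ∞) : WithTop ℕ∞) P],
        HandleAttachingMap.IsMultiAttachment g (𝓡∂ 4) P →
          ∀ bP : BoundaryData (𝓡∂ 4) P (𝓡 3), L.IsSurgery (𝓡 3) bP.carrier :=
  fun _ L g ν hfr hνdisj hbd _ _ _ _ hP bP =>
    L.isSurgery_boundary_of_isMultiAttachment g ν hfr hνdisj hbd hP bP

end Summit.SmoothPoincare4.SmoothPoincare4.Theorems.VrlComponentsHBallSlice.KirbyLemma21

end
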